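import Summits.QuantumFields.GaugeBoot.SUNWeakCouplingRate
import Summits.QuantumFields.GaugeBoot.SU2WeakCouplingRateUniform
import Literature.MathematicalPhysics.QuantumLattice.LatticeGaugeDLRFreeEnergyProofs
import HarnessLib

/-!
# Gauge-boot: the infinite-volume plaquette is governed by the chords of the free energy density
# (supplement 21, part 1 — Griffiths' convexity lemma for the Wilson action)

HONEST FRAMING (cell `pub-gaugeboot`, page 1 of every file): certified bounds on lattice
expectations at STATED coupling, gauge group, dimension and torus size; NOT a mass gap, NOT a
continuum limit, NOT a string tension, NOT large `N`; NOT Yang–Mills-summit-bearing (barriers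
`FixedCouplingUltralocality`, `PerturbativeInvisibility`).  This file is a structural statement about
the thermodynamic limit of the mean Wilson action at FIXED coupling; it certifies no number of the
cell's tables.

## Content

For a compact second-countable gauge group `G`, a continuous `N`-dimensional representation `ρ`,
every dimension `d` and every real coupling `β`, let `f(β) = lim_L |Λ_L|⁻¹ log Z_{Λ_L,β}` be the
torus free energy density per site (it exists: tree `exists_hasFreeEnergyDensity_holds`) and
`actionDensity ρ β L = |Λ_L|⁻¹ ⟨S⟩_{β,L}` the mean Wilson action per site on the torus `(ℤ/L)^d`.

* `actionDensity ρ d β L = |Λ_L|⁻¹⟨S⟩_{β,L}`; `actionDensity_le_chord`, `chord_le_actionDensity` — the supporting-line inequality of the tree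
  (`mul_wilsonExpectation_wilsonAction_le`) per site: for `β' < β < β''`,
  `(|Λ|⁻¹ log Z(β) − |Λ|⁻¹ log Z(β''))/(β'' − β) ≤ |Λ|⁻¹⟨S⟩_β ≤ (|Λ|⁻¹ log Z(β') − |Λ|⁻¹ log Z(β))/(β − β')`;
* ★ `eventually_actionDensity_le_chord`, `eventually_chord_le_actionDensity` — GRIFFITHS' LEMMA: for
  every `ε > 0`, for all large `L`,
  `(f β − f β'')/(β'' − β) − ε ≤ actionDensity ρ β (L+1) ≤ (f β' − f β)/(β − β') + ε`;
* `actionDensity_eq_card_mul` — `|Λ|⁻¹⟨S⟩_{β,L} = #{i<j} · (N − ⟨Re tr ρ(U_{x;ij})⟩_{β,L})` for every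
  plaquette `(x; i ≠ j)` (torus symmetry, `wilsonExpectation_meanPlaquette_eq_plaquetteTrace`);
* ★★ `chord_le_of_mem_limitPoints`, `le_chord_of_mem_limitPoints` — at EVERY infinite-volume limit
  point `μ` of the torus Wilson states and for every plaquette of `ℤ^d`:
  `(f β − f β'')/(β'' − β) ≤ #{i<j} · (N − ∫ Re tr ρ(U_P) dμ) ≤ (f β' − f β)/(β − β')`;
* ★★ `eq_neg_deriv_of_mem_limitPoints` — if `f` is differentiable at `β`, ALL limit points give every
  plaquette the same expectation: `#{i<j} · (N − ∫ Re tr ρ(U_P) dμ) = −f'(β)`;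
Part 1b (`FreeEnergyPlaquetteAsymptotics`) extracts the sharp `1/β` law from `f(β) + a log β → K`;
part 2 feeds Chatterjee's theorem (`a = (d−1)N²/2` for `U(N)`).

[folklore] (R. B. Griffiths, J. Math. Phys. 5 (1964) 1215, Lemma on limits of convex functions;
S. Friedli, Y. Velenik, *Statistical Mechanics of Lattice Systems* (2017) Thm. 3.6, App. B.2;
E. Seiler, LNP 159 (1982) Ch. 2 for the lattice gauge setting.)
-/

noncomputable section

open MeasureTheory Filter Topology
open Literature.MathematicalPhysics.QuantumFieldTheory
open Literature.MathematicalPhysics.QuantumLattice (LGConfig plaquetteObs plaquetteHolonomyZd IsCylinder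
  IsInfiniteVolumeLimitAlong infiniteVolumeLimitPoints torusLogPartition HasFreeEnergyDensity freeEnergyDensity
  hasFreeEnergyDensity_freeEnergyDensity exists_hasFreeEnergyDensity_holds toTorusObservable)
open Literature.RepresentationTheory.CompactGroups

namespace Summit.QuantumFields.GaugeBoot

variable {d N : ℕ} {G : Type*} [Group G] [TopologicalSpace G] [IsTopologicalGroup G]
  [CompactSpace G] [MeasurableSpace G] [BorelSpace G] (ρ : G →* Matrix (Fin N) (Fin N) ℂ)

/-! ## The mean action per site and the chords of `log Z` -/

/-- The mean Wilson action per site `|Λ_L|⁻¹ ⟨S⟩_{β,L}` on the torus `(ℤ/L)^d` (`|Λ_L| = L^d`). -/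
def actionDensity (d : ℕ) (β : ℝ) (L : ℕ) [NeZero L] : ℝ :=
  ((L : ℝ) ^ d)⁻¹ * wilsonExpectation ρ β (wilsonAction (d := d) (L := L) (G := G) ρ)

/-- Upper chord: for `β' < β`, `|Λ|⁻¹⟨S⟩_β ≤ (|Λ|⁻¹ log Z(β') − |Λ|⁻¹ log Z(β))/(β − β')`. [folklore] -/
theorem actionDensity_le_chord {L : ℕ} [NeZero L] (hρ : Continuous ρ) {β' β : ℝ} (h : β' < β) :
    actionDensity ρ d β L ≤
      (((L : ℝ) ^ d)⁻¹ * torusLogPartition d ρ β' L - ((L : ℝ) ^ d)⁻¹ * torusLogPartition d ρ β L) / (β - β') := by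
  have hs := mul_wilsonExpectation_wilsonAction_le (d := d) (L := L) ρ hρ β β'
  have hpos : 0 < β - β' := sub_pos.2 h
  have hL : 0 ≤ ((L : ℝ) ^ d)⁻¹ := by positivity
  unfold actionDensity
  rw [le_div_iff₀ hpos, ← mul_sub]
  calc ((L : ℝ) ^ d)⁻¹ * wilsonExpectation ρ β (wilsonAction (d := d) (L := L) (G := G) ρ) * (β - β')
      = ((L : ℝ) ^ d)⁻¹ * ((β - β') * wilsonExpectation ρ β (wilsonAction (d := d) (L := L) (G := G) ρ)) := by ring
    _ ≤ ((L : ℝ) ^ d)⁻¹ * (torusLogPartition d ρ β' L - torusLogPartition d ρ β L) :=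
        mul_le_mul_of_nonneg_left hs hL

/-- Lower chord: for `β < β''`, `(|Λ|⁻¹ log Z(β) − |Λ|⁻¹ log Z(β''))/(β'' − β) ≤ |Λ|⁻¹⟨S⟩_β`. [folklore] -/
theorem chord_le_actionDensity {L : ℕ} [NeZero L] (hρ : Continuous ρ) {β β'' : ℝ} (h : β < β'') :
    (((L : ℝ) ^ d)⁻¹ * torusLogPartition d ρ β L - ((L : ℝ) ^ d)⁻¹ * torusLogPartition d ρ β'' L) / (β'' - β) ≤
      actionDensity ρ d β L := by
  have hs := mul_wilsonExpectation_wilsonAction_le (d := d) (L := L) ρ hρ β β''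
  have hpos : 0 < β'' - β := sub_pos.2 h
  have hL : 0 ≤ ((L : ℝ) ^ d)⁻¹ := by positivity
  unfold actionDensity
  rw [div_le_iff₀ hpos, ← mul_sub]
  have h1 : ((L : ℝ) ^ d)⁻¹ * ((β - β'') * wilsonExpectation ρ β (wilsonAction (d := d) (L := L) (G := G) ρ)) ≤
      ((L : ℝ) ^ d)⁻¹ * (torusLogPartition d ρ β'' L - torusLogPartition d ρ β L) :=
    mul_le_mul_of_nonneg_left hs hL
  linarith

/-! ## Griffiths' lemma: the chords of the limit control the limit of the mean action -/

section Limit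

variable [SecondCountableTopology G]

/-- The free energy density per site exists at every coupling (tree). [folklore] -/
theorem hasFreeEnergyDensity (hρ : Continuous ρ) (β : ℝ) :
    HasFreeEnergyDensity d ρ β (freeEnergyDensity d ρ β) :=
  hasFreeEnergyDensity_freeEnergyDensity ρ (exists_hasFreeEnergyDensity_holds (d := d) ρ hρ β)

/-- ★ **Griffiths' lemma, upper half**: for `β' < β` and every `ε > 0`, for all large `L`,
`|Λ_{L+1}|⁻¹⟨S⟩_{β,L+1} ≤ (f β' − f β)/(β − β') + ε`. [folklore] -/
theorem eventually_actionDensity_le_chord (hρ : Continuous ρ) {β' β : ℝ} (h : β' < β) {ε : ℝ} (hε : 0 < ε) :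
    ∀ᶠ L : ℕ in atTop, actionDensity ρ d β (L + 1) ≤
      (freeEnergyDensity d ρ β' - freeEnergyDensity d ρ β) / (β - β') + ε := by
  have hpos : 0 < β - β' := sub_pos.2 h
  have ht : Tendsto (fun L : ℕ => ((((L + 1 : ℕ) : ℝ) ^ d)⁻¹ * torusLogPartition d ρ β' (L + 1) -
      (((L + 1 : ℕ) : ℝ) ^ d)⁻¹ * torusLogPartition d ρ β (L + 1)) / (β - β')) atTop
      (𝓝 ((freeEnergyDensity d ρ β' - freeEnergyDensity d ρ β) / (β - β'))) :=
    ((hasFreeEnergyDensity ρ hρ β').sub (hasFreeEnergyDensity ρ hρ β)).div_const _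
  have hev := (tendsto_order.1 ht).2 _ (lt_add_of_pos_right _ hε)
  filter_upwards [hev] with L hL
  exact ((actionDensity_le_chord (d := d) (L := L + 1) ρ hρ h).trans_eq (by push_cast; ring_nf)).trans hL.le

/-- ★ **Griffiths' lemma, lower half**: for `β < β''` and every `ε > 0`, for all large `L`,
`(f β − f β'')/(β'' − β) − ε ≤ |Λ_{L+1}|⁻¹⟨S⟩_{β,L+1}`. [folklore] -/
theorem eventually_chord_le_actionDensity (hρ : Continuous ρ) {β β'' : ℝ} (h : β < β'') {ε : ℝ} (hε : 0 < ε) :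
    ∀ᶠ L : ℕ in atTop, (freeEnergyDensity d ρ β - freeEnergyDensity d ρ β'') / (β'' - β) - ε ≤
      actionDensity ρ d β (L + 1) := by
  have ht : Tendsto (fun L : ℕ => ((((L + 1 : ℕ) : ℝ) ^ d)⁻¹ * torusLogPartition d ρ β (L + 1) -
      (((L + 1 : ℕ) : ℝ) ^ d)⁻¹ * torusLogPartition d ρ β'' (L + 1)) / (β'' - β)) atTop
      (𝓝 ((freeEnergyDensity d ρ β - freeEnergyDensity d ρ β'') / (β'' - β))) :=
    ((hasFreeEnergyDensity ρ hρ β).sub (hasFreeEnergyDensity ρ hρ β'')).div_const _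
  have hev := (tendsto_order.1 ht).1 _ (sub_lt_self _ hε)
  filter_upwards [hev] with L hL
  exact hL.le.trans ((chord_le_actionDensity (d := d) (L := L + 1) ρ hρ h).trans_eq' (by push_cast; ring_nf))

end Limit

/-! ## The mean action per site is `#{i<j}` single-plaquette costs -/

/-- `|Λ_L|⁻¹⟨S⟩_{β,L} = #{i<j} · (N − ⟨Re tr ρ(U_{x;ij})⟩_{β,L})` for every plaquette `(x; i ≠ j)` of the torus
(`N ≥ 1`; translation and axis symmetry of the torus state). [folklore] -/
theorem actionDensity_eq_card_mul {L : ℕ} [NeZero L] (hρ : Continuous ρ) (hN : N ≠ 0) (β : ℝ) (x : Site d L)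
    {i j : Fin d} (hij : i ≠ j) :
    actionDensity ρ d β L = (Fintype.card {p : Fin d × Fin d // p.1 < p.2} : ℝ) *
      ((N : ℝ) - N * wilsonExpectation ρ β (plaquetteTrace ρ x i j)) := by
  haveI : Nonempty (Plaquette d L) := ⟨(x, ⟨(min i j, max i j), min_lt_max.2 hij⟩)⟩
  have hmean := wilsonExpectation_meanPlaquette_eq (d := d) (L := L) (G := G) ρ hρ hN β
  rw [wilsonExpectation_meanPlaquette_eq_plaquetteTrace ρ hρ β x hij] at hmean
  have hP : (Fintype.card (Plaquette d L) : ℝ) = (L : ℝ) ^ d * Fintype.card {p : Fin d × Fin d // p.1 < p.2} := by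
    have hsite : Fintype.card (Site d L) = L ^ d := by
      rw [Fintype.card_fun, ZMod.card, Fintype.card_fin]
    rw [SU2Rate.card_plaquette_eq, hsite]; push_cast; ring
  have hNpos : (0 : ℝ) < N := by exact_mod_cast Nat.pos_of_ne_zero hN
  have hLpos : (0 : ℝ) < (L : ℝ) ^ d := by
    have : (0 : ℝ) < L := by exact_mod_cast Nat.pos_of_ne_zero (NeZero.ne L)
    positivity
  have hcard : (0 : ℝ) < Fintype.card (Plaquette d L) := by exact_mod_cast Fintype.card_pos
  have hS : wilsonExpectation ρ β (wilsonAction (d := d) (L := L) (G := G) ρ) =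
      (N * Fintype.card (Plaquette d L)) * (1 - wilsonExpectation ρ β (plaquetteTrace ρ x i j)) := by
    have hne : (N : ℝ) * Fintype.card (Plaquette d L) ≠ 0 := by positivity
    field_simp at hmean
    linarith [hmean]
  unfold actionDensity
  rw [hS, hP]
  field_simp

/-! ## Infinite-volume limit points -/

section LimitPoints

variable [SecondCountableTopology G]

omit [SecondCountableTopology G] in
/-- Along a subsequence of tori converging to the limit point `μ`, the single-plaquette expectations
converge: `⟨u_{x;ij}⟩_{β,L_k+1} → ∫ (1/N) Re tr ρ(U_{x;ij}) dμ`. [folklore] -/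
theorem tendsto_wilsonExpectation_plaquetteTrace (hρ : Continuous ρ) {β : ℝ} {Lk : ℕ → ℕ}
    {μ : Measure (LGConfig d G)} (hμ : IsInfiniteVolumeLimitAlong ρ β Lk μ)
    (x : Literature.Probability.LatticeModels.Site d) (i j : Fin d) :
    Tendsto (fun k : ℕ => wilsonExpectation ρ β
        (plaquetteTrace ρ (Literature.Probability.LatticeModels.Torus.proj (Lk k + 1) x) i j)) atTop
      (𝓝 (∫ U, (N : ℝ)⁻¹ * plaquetteObs ρ x i j U ∂μ)) := by
  set F : LGConfig d G → ℝ := fun U => (N : ℝ)⁻¹ * plaquetteObs ρ x i j U with hF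
  have hcyl : IsCylinder F ({(x, i), (x + Pi.single i 1, j), (x + Pi.single j 1, i), (x, j)} :
      Finset (Literature.MathematicalPhysics.QuantumLattice.ZdEdge d)) := by
    intro U V hUV
    simp only [hF, plaquetteObs, plaquetteHolonomyZd]
    rw [hUV (x, i) (by simp), hUV (x + Pi.single i 1, j) (by simp), hUV (x + Pi.single j 1, i) (by simp),
      hUV (x, j) (by simp)]
  have hcont : Continuous F := by
    have h1 : Continuous fun U : LGConfig d G => plaquetteHolonomyZd U x i j := by
      unfold plaquetteHolonomyZd; fun_prop
    exact continuous_const.mul ((continuous_trace_re ρ hρ).comp h1)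
  have hbd : ∃ C, ∀ U, |F U| ≤ C := by
    refine ⟨(N : ℝ)⁻¹ * N, fun U => ?_⟩
    have h := CompactGroup.abs_re_trace_le_card ρ hρ (plaquetteHolonomyZd U x i j)
    rw [Fintype.card_fin] at h
    simp only [hF, plaquetteObs]
    rw [abs_mul, abs_inv, Nat.abs_cast]
    gcongr
  have htend := hμ.2 F _ hcyl hcont hbd
  have hFt : ∀ L : ℕ, toTorusObservable L F =
      plaquetteTrace ρ (Literature.Probability.LatticeModels.Torus.proj L x) i j := fun L =>
    toTorusObservable_plaquetteObs ρ L x i j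
  simp only [hFt] at htend
  exact htend

omit [SecondCountableTopology G] in
/-- Along the subsequence, the mean action per site converges to `#{i<j} · (N − ∫ Re tr ρ(U_P) dμ)`. [folklore] -/
theorem tendsto_actionDensity (hρ : Continuous ρ) (hN : N ≠ 0) {β : ℝ} {Lk : ℕ → ℕ}
    {μ : Measure (LGConfig d G)} (hμ : IsInfiniteVolumeLimitAlong ρ β Lk μ)
    (x : Literature.Probability.LatticeModels.Site d) {i j : Fin d} (hij : i ≠ j) :
    Tendsto (fun k : ℕ => actionDensity ρ d β (Lk k + 1)) atTop
      (𝓝 ((Fintype.card {p : Fin d × Fin d // p.1 < p.2} : ℝ) * ((N : ℝ) - ∫ U, plaquetteObs ρ x i j U ∂μ))) := by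
  have hNpos : (0 : ℝ) < N := by exact_mod_cast Nat.pos_of_ne_zero hN
  have ht := tendsto_wilsonExpectation_plaquetteTrace (d := d) ρ hρ hμ x i j
  have h2 : Tendsto (fun k : ℕ => (Fintype.card {p : Fin d × Fin d // p.1 < p.2} : ℝ) *
      ((N : ℝ) - N * wilsonExpectation ρ β
        (plaquetteTrace ρ (Literature.Probability.LatticeModels.Torus.proj (Lk k + 1) x) i j))) atTop
      (𝓝 ((Fintype.card {p : Fin d × Fin d // p.1 < p.2} : ℝ) *
        ((N : ℝ) - N * ∫ U, (N : ℝ)⁻¹ * plaquetteObs ρ x i j U ∂μ))) :=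
    (tendsto_const_nhds.sub (ht.const_mul _)).const_mul _
  rw [integral_const_mul, ← mul_assoc, mul_inv_cancel₀ hNpos.ne', one_mul] at h2
  refine h2.congr fun k => ?_
  rw [actionDensity_eq_card_mul (d := d) (L := Lk k + 1) ρ hρ hN β _ hij]

/-- ★★ **Upper chord bound at every limit point**: for `β' < β`, every infinite-volume limit point `μ`
of the torus Wilson states at `β` and every plaquette `(x; i ≠ j)` of `ℤ^d`,
`#{i<j} · (N − ∫ Re tr ρ(U_{x;ij}) dμ) ≤ (f β' − f β)/(β − β')`. [folklore] -/
theorem le_chord_of_mem_limitPoints (hρ : Continuous ρ) (hN : N ≠ 0) {β' β : ℝ} (h : β' < β)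
    {μ : Measure (LGConfig d G)} (hμ : μ ∈ infiniteVolumeLimitPoints (d := d) ρ β)
    (x : Literature.Probability.LatticeModels.Site d) {i j : Fin d} (hij : i ≠ j) :
    (Fintype.card {p : Fin d × Fin d // p.1 < p.2} : ℝ) * ((N : ℝ) - ∫ U, plaquetteObs ρ x i j U ∂μ) ≤
      (freeEnergyDensity d ρ β' - freeEnergyDensity d ρ β) / (β - β') := by
  obtain ⟨Lk, hmono, hlim⟩ := hμ
  have ht := tendsto_actionDensity (d := d) ρ hρ hN hlim x hij
  refine le_of_forall_pos_le_add fun ε hε => ?_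
  have hev := (eventually_actionDensity_le_chord (d := d) ρ hρ h hε)
  have hev' : ∀ᶠ k : ℕ in atTop, actionDensity ρ d β (Lk k + 1) ≤
      (freeEnergyDensity d ρ β' - freeEnergyDensity d ρ β) / (β - β') + ε :=
    hmono.tendsto_atTop.eventually hev
  exact le_of_tendsto ht hev'

/-- ★★ **Lower chord bound at every limit point**: for `β < β''`,
`(f β − f β'')/(β'' − β) ≤ #{i<j} · (N − ∫ Re tr ρ(U_{x;ij}) dμ)`. [folklore] -/
theorem chord_le_of_mem_limitPoints (hρ : Continuous ρ) (hN : N ≠ 0) {β β'' : ℝ} (h : β < β'')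
    {μ : Measure (LGConfig d G)} (hμ : μ ∈ infiniteVolumeLimitPoints (d := d) ρ β)
    (x : Literature.Probability.LatticeModels.Site d) {i j : Fin d} (hij : i ≠ j) :
    (freeEnergyDensity d ρ β - freeEnergyDensity d ρ β'') / (β'' - β) ≤
      (Fintype.card {p : Fin d × Fin d // p.1 < p.2} : ℝ) * ((N : ℝ) - ∫ U, plaquetteObs ρ x i j U ∂μ) := by
  obtain ⟨Lk, hmono, hlim⟩ := hμ
  have ht := tendsto_actionDensity (d := d) ρ hρ hN hlim x hij
  refine le_of_forall_pos_le_add fun ε hε => ?_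
  have hev := (eventually_chord_le_actionDensity (d := d) ρ hρ h hε)
  have hev' : ∀ᶠ k : ℕ in atTop, (freeEnergyDensity d ρ β - freeEnergyDensity d ρ β'') / (β'' - β) - ε ≤
      actionDensity ρ d β (Lk k + 1) :=
    hmono.tendsto_atTop.eventually hev
  have := ge_of_tendsto ht hev'
  linarith

/-- ★★ **Where the free energy density is differentiable, all limit points share the plaquette**: if
`f` has derivative `f'` at `β`, then at every infinite-volume limit point `μ` at `β` and for every
plaquette, `#{i<j} · (N − ∫ Re tr ρ(U_P) dμ) = −f'` (so the thermodynamic limit of the mean plaquette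
exists along the full sequence of tori and does not depend on the subsequence). [folklore] -/
theorem eq_neg_deriv_of_mem_limitPoints (hρ : Continuous ρ) (hN : N ≠ 0) {β f' : ℝ}
    (hf : HasDerivAt (freeEnergyDensity d ρ) f' β)
    {μ : Measure (LGConfig d G)} (hμ : μ ∈ infiniteVolumeLimitPoints (d := d) ρ β)
    (x : Literature.Probability.LatticeModels.Site d) {i j : Fin d} (hij : i ≠ j) :
    (Fintype.card {p : Fin d × Fin d // p.1 < p.2} : ℝ) * ((N : ℝ) - ∫ U, plaquetteObs ρ x i j U ∂μ) = -f' := by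
  set v := (Fintype.card {p : Fin d × Fin d // p.1 < p.2} : ℝ) * ((N : ℝ) - ∫ U, plaquetteObs ρ x i j U ∂μ)
  have hl := hf.tendsto_slope_zero_left
  have hr := hf.tendsto_slope_zero_right
  have hslope : ∀ t : ℝ, t ≠ 0 →
      (freeEnergyDensity d ρ (β + t) - freeEnergyDensity d ρ β) / (β - (β + t)) =
        -(t⁻¹ • (freeEnergyDensity d ρ (β + t) - freeEnergyDensity d ρ β)) := fun t ht => by
    rw [smul_eq_mul, show β - (β + t) = -t by ring, div_neg, div_eq_inv_mul]
  have hslope' : ∀ t : ℝ, t ≠ 0 →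
      (freeEnergyDensity d ρ β - freeEnergyDensity d ρ (β + t)) / (β + t - β) =
        -(t⁻¹ • (freeEnergyDensity d ρ (β + t) - freeEnergyDensity d ρ β)) := fun t ht => by
    rw [smul_eq_mul, show β + t - β = t by ring, div_eq_inv_mul]
    ring
  -- upper: `v ≤ -(t⁻¹ (f (β + t) - f β))` for `t < 0`, and the right-hand side tends to `-f'`
  have hup : v ≤ -f' := by
    have hev : ∀ᶠ t : ℝ in 𝓝[<] 0, v ≤ -(t⁻¹ • (freeEnergyDensity d ρ (β + t) - freeEnergyDensity d ρ β)) := by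
      refine eventually_nhdsWithin_of_forall fun t (ht : t < 0) => ?_
      rw [← hslope t ht.ne]
      exact le_chord_of_mem_limitPoints (d := d) ρ hρ hN (β' := β + t) (by linarith) hμ x hij
    exact le_of_tendsto_of_tendsto tendsto_const_nhds hl.neg hev
  -- lower: `-(t⁻¹ (f (β + t) - f β)) ≤ v` for `t > 0`
  have hlow : -f' ≤ v := by
    have hev : ∀ᶠ t : ℝ in 𝓝[>] 0, -(t⁻¹ • (freeEnergyDensity d ρ (β + t) - freeEnergyDensity d ρ β)) ≤ v := by
      refine eventually_nhdsWithin_of_forall fun t (ht : 0 < t) => ?_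
      rw [← hslope' t ht.ne']
      exact chord_le_of_mem_limitPoints (d := d) ρ hρ hN (β'' := β + t) (by linarith) hμ x hij
    exact le_of_tendsto_of_tendsto hr.neg tendsto_const_nhds hev
  exact le_antisymm hup hlow

end LimitPoints



end Summit.QuantumFields.GaugeBoot

end
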